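import Summits.HodgeConjecture.HodgeConjecture.Theses.EndoscopicMiddleDegree
import Literature.AlgebraicGeometry.HodgeTheory.ComplexGysinCorrespondence
import Literature.AlgebraicGeometry.HodgeTheory.SupportedHodgeClassDescent
import Literature.AlgebraicGeometry.HodgeTheory.GysinBaseChangeOfKunneth
import Mathlib.AlgebraicGeometry.Morphisms.Finite

/-!
# Crux `IsotypicMiddleClassesAlgebraic` (stmt-HodgeConjecture-14301) — line `IdeatorFiveSketch`
(idea `noncongruence-divisor-ring`, ideator 5), lead's RESHAPED skeleton (seat a2, 2026-08-16)

The filed sketch (`Cruxes/IsotypicMiddleClassesAlgebraic/IdeatorFiveSketch.lean`) proves the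
tightness lemma `DivisorialInvisibility` and types the NECESSARY transfer
`CoverDivisorNonVanishing`; it has no theorem concluding the crux. This skeleton supplies the
composition from the card's SUFFICIENT transfer C⁺⁺ ("on one finite cover `f : X' → X` of non-zero
degree, `f^* c` lies in the degree-`n` span of divisor monomials"):

* `divisorPowerSpan Y k ⊆ H^{2k}(Y(ℂ); ℂ)` — the span of monomials `d₁ ∪ ⋯ ∪ d_k` in divisor
  classes `dᵢ ∈ algebraicClasses Y 1` (recursive on `k`, `divisorPowerSpan Y 0 = H⁰`);
* `divisorPowerSpan_le_algebraicClasses` — divisor monomials are algebraic, given the route support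
  `CupProductAlgebraic` (stmt-HodgeConjecture-14350);
* `stub_coverDescent` (LANDED as a `Theorems/` file) — ALGEBRAICITY DESCENDS ALONG MAPS OF NON-ZERO DEGREE: if
  `f : X' ⟶ X` (smooth projective, same dimension) has `f_* 1 ≠ 0` and `f^* c` is algebraic, then
  `c` is algebraic (`f_* f^* c = c ∪ f_* 1 = t • c`, `t ≠ 0`, by the projection formula
  `complexGysin_cup`, `H⁰(X(ℂ)) = ℂ · 1` (`exists_eq_smul_one`), and push-forwards of algebraic
  classes are algebraic (`complexGysin_mem_algebraicClasses` with the PROVED support property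
  `gysinMap_restrictCompl_eq_zero_of_field ℂ`); Poincaré duality is the theorem
  `OrientationFamily.hasPoincareDuality`);
* `stub_coverDivisorSupply` — THE SUPPLY (the line's one load-bearing stub, `sorry`): for every
  admissible `(μ, m, X, D, γ)` and every rational `P`-fixed `c` there is a FINITE `f : X' ⟶ X` from a
  smooth projective `X'` of the same dimension with `f_* 1 ≠ 0` and `f^* c ∈ divisorPowerSpan X' (m+1)`;
* `isotypicMiddleClassesAlgebraic_of` — `CupProductAlgebraic → crux`, modulo the stub, BY NAME.

Finiteness of `f` is not used by the composition; it is what keeps the stub from being the crux in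
costume: with `f` merely of non-zero degree (blow-ups allowed) the stub is implied by the crux on
paper (every algebraic class becomes a divisor polynomial on a birational modification: resolve
`𝒪_Z` by bundles, split them on the closure of a rational section of the flag bundle, resolve).
-/

noncomputable section

namespace Summit.HodgeConjecture.HodgeConjecture.Cruxes.IsotypicMiddleClassesAlgebraic.IdeatorFive

set_option linter.dupNamespace false

open CategoryTheory MonoidalCategory CartesianMonoidalCategory
open Literature.AlgebraicGeometry Literature.AlgebraicGeometry.HodgeTheory
open Literature.AlgebraicGeometry.Motives
open Literature.AlgebraicGeometry.ShimuraVarieties Literature.AlgebraicTopology.SingularHomology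
open Summit.HodgeConjecture.HodgeConjecture.Theses

/-! ### Divisor monomials -/

/-- The span `D_k(Y) ⊆ H^{2k}(Y(ℂ); ℂ)` of the monomials `d₁ ∪ ⋯ ∪ d_k` in divisor classes
`dᵢ ∈ algebraicClasses Y 1`, defined recursively: `D_0 = H⁰`, `D_{k+1} = span {a ∪ d : a ∈ D_k,
d ∈ algebraicClasses Y 1}`. (For `Y` smooth projective this is the tree's
`Literature.Barriers.HodgeConjecture.divisorClassesSpan Y N k` — van Geemen's `Dᵏ ⊗ ℂ`, built from
RATIONAL `(1,1)`-classes — modulo Lefschetz `(1,1)` (`lefschetzOneOne_rational`, unproved named fact)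
and `H⁰ = ℂ · 1`; the present spelling through `algebraicClasses Y 1` keeps the composition below
free of that named fact. Local to this crux workfile; not proposed anywhere.) -/
def divisorPowerSpan (Y : SchemeOver ℂ) : (k : ℕ) → Submodule ℂ (complexBetti Y (2 * k))
  | 0 => ⊤
  | k + 1 => Submodule.span ℂ {z | ∃ a ∈ divisorPowerSpan Y k, ∃ d ∈ algebraicClasses Y 1,
      z = cupProduct (two_mul_add_two_mul k 1) a d}

/-- Divisor monomials are algebraic: `D_k(Y) ≤ algebraicClasses Y k` for `Y` smooth projective,
given the route support `CupProductAlgebraic` (cup products of algebraic classes are algebraic;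
`D_0 = H⁰ = algebraicClasses Y 0` by `algebraicClasses_zero`). -/
theorem divisorPowerSpan_le_algebraicClasses (h9 : EndoscopicMiddleDegree.CupProductAlgebraic)
    {n : ℕ} {Y : SchemeOver ℂ} (hY : IsSmoothProjective n Y) :
    ∀ k, divisorPowerSpan Y k ≤ algebraicClasses Y k
  | 0 => by
      rw [algebraicClasses_zero]
      exact le_top
  | k + 1 => by
      refine Submodule.span_le.2 ?_
      rintro z ⟨a, ha, d, hd, rfl⟩
      exact h9 hY k 1 a d (divisorPowerSpan_le_algebraicClasses h9 hY k ha) hd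

/-! ### Algebraicity descends along maps of non-zero degree (stub, LANDED separately) -/

/-- **Descent of algebraicity along a map of non-zero degree** (stub `stub_coverDescent`; proved in
`Theorems/EndoscopicMiddleDegreeIsotypicMiddleClassesAlgebraicCoverDescent.lean`, restated here with
`sorry` until the hub builds that module). For `f : X' ⟶ X` between smooth projective varieties of
the same dimension `n` with `f_* 1 ≠ 0` in `H⁰(X(ℂ); ℂ) = ℂ · 1`, a class `c ∈ H^{2p}(X(ℂ); ℂ)`
whose pull-back `f^* c` is algebraic is algebraic: `f_*(f^* c) = f_*(f^* c ∪ 1) = c ∪ f_* 1 = t • c`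
with `t ≠ 0` (`complexGysin_cup`, `exists_eq_smul_one`), and `f_*` preserves algebraic classes
(`complexGysin_mem_algebraicClasses`, `gysinMap_restrictCompl_eq_zero_of_field ℂ`). -/
theorem stub_coverDescent (μ : OrientationFamily) {n : ℕ} {X' X : SchemeOver ℂ}
    (hX' : IsSmoothProjective n X') (hX : IsSmoothProjective n X) (f : X' ⟶ X)
    (hdeg : complexGysin μ hX' hX f (rfl : 0 + 2 * n = 0 + 2 * n)
      (singularCohomology.one ℂ (ComplexPoints X')) ≠ 0)
    {p : ℕ} (c : complexBetti X (2 * p))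
    (hc : complexBetti.map f (2 * p) c ∈ algebraicClasses X' p) :
    c ∈ algebraicClasses X p := by
  sorry

/-! ### The supply stub -/

/-- **SUPPLY (the line's load-bearing stub; card `noncongruence-divisor-ring`, transfer C⁺⁺).**
For every admissible `(μ, m, X, D, γ)` of the crux (`P = γ_*` preserving rational classes, with
purely `(n,n)` image, `n = m+1`) and every rational `P`-fixed class `c`, there is a FINITE morphism
`f : X' ⟶ X` from a smooth projective `X'` of the same dimension `2n`, of non-zero degree
(`f_* 1 ≠ 0`), such that `f^* c` is a `ℂ`-combination of monomials `d₁ ∪ ⋯ ∪ d_n` in divisor classes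
of `X'`. Intended witnesses (card §Supply): non-congruence (Kazhdan) étale covers and cyclic covers
branched along special divisors; by `DivisorialInvisibility` no congruence cover can serve for a
class orthogonal to the theta world. OPEN on paper ((B-new-1)/(B-new-2) of the card) and not
constructible in the tree (no datum `D` is, Disproof F0). -/
theorem stub_coverDivisorSupply (μ : OrientationFamily) (hμ : μ.HasPoincareDuality) (m : ℕ)
    (X : SchemeOver ℂ) (D : UnitaryBallQuotientDatum (2 * (m + 1)) X) (h1 : 1 ≤ m) (h2 : m ≤ 2)
    (γ : complexBetti (X ⊗ X) (2 * (2 * (m + 1))))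
    (hγ : γ ∈ algebraicClasses (X ⊗ X) (2 * (m + 1)))
    (hPrat : ∀ β, IsRationalClass β → IsRationalClass (corrAction μ D.isSmoothProjective
      D.isSmoothProjective (rfl : 2 * (m + 1) + 2 * (2 * (m + 1)) = 2 * (m + 1) + 2 * (2 * (m + 1))) γ β))
    (hPhdg : ∀ β, IsOfHodgeType (2 * (m + 1)) X (2 * (m + 1)) (m + 1) (m + 1)
      (corrAction μ D.isSmoothProjective D.isSmoothProjective
        (rfl : 2 * (m + 1) + 2 * (2 * (m + 1)) = 2 * (m + 1) + 2 * (2 * (m + 1))) γ β))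
    (c : complexBetti X (2 * (m + 1))) (hc : IsRationalClass c)
    (hPc : corrAction μ D.isSmoothProjective D.isSmoothProjective
      (rfl : 2 * (m + 1) + 2 * (2 * (m + 1)) = 2 * (m + 1) + 2 * (2 * (m + 1))) γ c = c) :
    ∃ (X' : SchemeOver ℂ) (hX' : IsSmoothProjective (2 * (m + 1)) X') (f : X' ⟶ X),
      AlgebraicGeometry.IsFinite f.left ∧
      complexGysin μ hX' D.isSmoothProjective f
          (rfl : 0 + 2 * (2 * (m + 1)) = 0 + 2 * (2 * (m + 1)))
          (singularCohomology.one ℂ (ComplexPoints X')) ≠ 0 ∧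
      complexBetti.map f (2 * (m + 1)) c ∈ divisorPowerSpan X' (m + 1) := by
  sorry

/-! ### Composition -/

/-- **Line `IdeatorFiveSketch` closes the crux modulo its supply stub**: given the route support
`CupProductAlgebraic` (stmt-HodgeConjecture-14350), `stub_coverDivisorSupply` implies
`IsotypicMiddleClassesAlgebraic` — pull `c` back to the cover, where it is a divisor polynomial,
hence algebraic; push forward and divide by the degree (`stub_coverDescent`). -/
theorem isotypicMiddleClassesAlgebraic_of (h9 : EndoscopicMiddleDegree.CupProductAlgebraic) :
    EndoscopicMiddleDegree.IsotypicMiddleClassesAlgebraic := by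
  intro μ hμ m X D h1 h2 γ hγ P hPrat hPhdg c hc hPc
  obtain ⟨X', hX', f, -, hdeg, hspan⟩ :=
    stub_coverDivisorSupply μ hμ m X D h1 h2 γ hγ hPrat hPhdg c hc hPc
  exact stub_coverDescent μ hX' D.isSmoothProjective f hdeg c
    (divisorPowerSpan_le_algebraicClasses h9 hX' (m + 1) hspan)

end Summit.HodgeConjecture.HodgeConjecture.Cruxes.IsotypicMiddleClassesAlgebraic.IdeatorFive

end
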